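import Mathlib
import Summits.MatrixMultiplication.MatrixMultiplication.Theorems.SnSubsetDichotomyPolynomialSlackInductionStep

/-!
# `SnSubsetDichotomy.PolynomialSlack`, line `transport-split-hull` — stub `eventually_le_of_min_le_two`

The two-step analogue of `eventually_le_of_min_le` (file `…InductionStep`), the real-analysis
skeleton of the induction on `n` of the level-one programme for the polynomial-slack thesis
(crux `stmt-MatrixMultiplication-8306`).  With `Q n := (n!)^{3/2} / P(n)` (`P(n)` the maximal volume
of a TPP triple in `S_n`, so `Q ≥ 1`), the combinatorics gives for `n ≥ n₁` the three-way recursion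
`Q n ≥ min (a·n^c) (min (n^κ · Q (n-1)) (n^κ' · Q (n-2)))` (no violator at exponent `c`, or a
violator fibring over `S_{n-1}` by one point with gain `n^κ`, or over `S_{n-2}` by two points with
gain `n^κ'`).  Conclusion: `a·n^c ≤ Q n` eventually.

Proof: a reduction to the one-step lemma.  Put `e := min κ (κ'/2) > 0` and
`R n := min (Q n) (max 1 (n^e) · Q (n-1)) ≥ 1`.  For `n ≥ max n₁ 1` the one-step recursion
`min (a·n^c) (n^e · R (n-1)) ≤ R n` holds: against `Q n` because
`n^e · R (n-1) ≤ n^e · Q (n-1) ≤ n^κ · Q (n-1)` and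
`n^e · R (n-1) ≤ n^e · max 1 ((n-1)^e) · Q (n-2) ≤ n^(e+e) · Q (n-2) ≤ n^κ' · Q (n-2)` (then `hstep`);
against `max 1 (n^e) · Q (n-1)` because `n^e · R (n-1) ≤ n^e · Q (n-1)`.  So
`eventually_le_of_min_le` gives `a·n^c ≤ R n ≤ Q n` for all large `n`.
-/

namespace Summit.MatrixMultiplication.MatrixMultiplication.Theorems.PolynomialSlack

-- `Summit.<Summit>.<Problem>` is the tree's mandated summit-side namespace; for this
-- single-conjunct summit the two coincide, so the file silences `dupNamespace`.
set_option linter.dupNamespace false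

open Filter Topology

/-- **Eventual polynomial lower bound from a two-step `min`-recursion** (registered stub
`eventually_le_of_min_le_two` of line `transport-split-hull`).  If `Q ≥ 1` and, for `n ≥ n₁`,
`min (a·n^c) (min (n^κ · Q (n-1)) (n^κ' · Q (n-2))) ≤ Q n` with `a, κ, κ' > 0`, then `a·n^c ≤ Q n`
for all large `n`.  Reduction to the one-step lemma `eventually_le_of_min_le` applied to
`R n := min (Q n) (max 1 (n^e) · Q (n-1))` with `e := min κ (κ'/2)`. [folklore] -/
theorem eventually_le_of_min_le_two (Q : ℕ → ℝ) (a c κ κ' : ℝ) (ha : 0 < a) (hκ : 0 < κ) (hκ' : 0 < κ')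
    (n₁ : ℕ) (hQ : ∀ n, 1 ≤ Q n)
    (hstep : ∀ n : ℕ, n₁ ≤ n →
      min (a * (n : ℝ) ^ c) (min ((n : ℝ) ^ κ * Q (n - 1)) ((n : ℝ) ^ κ' * Q (n - 2))) ≤ Q n) :
    ∃ n₀ : ℕ, ∀ n : ℕ, n₀ ≤ n → a * (n : ℝ) ^ c ≤ Q n := by
  -- the auxiliary exponent `e = min κ (κ'/2)`: `0 < e`, `e ≤ κ`, `e + e ≤ κ'`
  set e : ℝ := min κ (κ' / 2) with he_def
  have he0 : 0 < e := lt_min hκ (by linarith)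
  have heκ : e ≤ κ := min_le_left _ _
  have heκ' : e + e ≤ κ' := by
    have h := min_le_right κ (κ' / 2)
    linarith
  -- the auxiliary sequence `R n = min (Q n) (max 1 (n^e) · Q (n-1))`, with `1 ≤ R ≤ Q`
  set R : ℕ → ℝ := fun n => min (Q n) (max 1 ((n : ℝ) ^ e) * Q (n - 1)) with hR_def
  have hR1 : ∀ n, 1 ≤ R n := fun n =>
    le_min (hQ n) (one_le_mul_of_one_le_of_one_le (le_max_left _ _) (hQ (n - 1)))
  have hRQ : ∀ n, R n ≤ Q n := fun n => min_le_left _ _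
  -- the one-step recursion for `R`, valid for `n ≥ max n₁ 1`
  have hstepR : ∀ n : ℕ, max n₁ 1 ≤ n →
      min (a * (n : ℝ) ^ c) ((n : ℝ) ^ e * R (n - 1)) ≤ R n := by
    intro n hn
    have hn₁ : n₁ ≤ n := (le_max_left _ _).trans hn
    have hn1 : 1 ≤ n := (le_max_right _ _).trans hn
    have hx1 : (1 : ℝ) ≤ n := by exact_mod_cast hn1
    have hx0 : (0 : ℝ) < n := one_pos.trans_le hx1
    have hne : 0 ≤ (n : ℝ) ^ e := Real.rpow_nonneg hx0.le e
    have hQ1 : 0 ≤ Q (n - 1) := zero_le_one.trans (hQ (n - 1))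
    have hQ2 : 0 ≤ Q (n - 2) := zero_le_one.trans (hQ (n - 2))
    -- `n^e · R (n-1) ≤ n^e · Q (n-1)`
    have hA : (n : ℝ) ^ e * R (n - 1) ≤ (n : ℝ) ^ e * Q (n - 1) :=
      mul_le_mul_of_nonneg_left (hRQ (n - 1)) hne
    refine le_min ?_ ?_
    · -- against `Q n`: dominate both fibring entries of `hstep n`
      refine le_trans (min_le_min_left _ (le_min ?_ ?_)) (hstep n hn₁)
      · -- `n^e · R (n-1) ≤ n^κ · Q (n-1)`
        exact hA.trans (mul_le_mul_of_nonneg_right (Real.rpow_le_rpow_of_exponent_le hx1 heκ) hQ1)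
      · -- `n^e · R (n-1) ≤ n^e · max 1 ((n-1)^e) · Q (n-2) ≤ n^(e+e) · Q (n-2) ≤ n^κ' · Q (n-2)`
        have hsub : n - 1 - 1 = n - 2 := by omega
        have hB : R (n - 1) ≤ max 1 (((n - 1 : ℕ) : ℝ) ^ e) * Q (n - 2) := by
          have h := min_le_right (Q (n - 1)) (max 1 (((n - 1 : ℕ) : ℝ) ^ e) * Q (n - 1 - 1))
          rw [hsub] at h
          exact h
        have hmax : max 1 (((n - 1 : ℕ) : ℝ) ^ e) ≤ (n : ℝ) ^ e := by
          refine max_le (Real.one_le_rpow hx1 he0.le) ?_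
          exact Real.rpow_le_rpow (Nat.cast_nonneg _) (by exact_mod_cast Nat.sub_le n 1) he0.le
        have hee : (n : ℝ) ^ e * (n : ℝ) ^ e ≤ (n : ℝ) ^ κ' := by
          rw [← Real.rpow_add hx0]
          exact Real.rpow_le_rpow_of_exponent_le hx1 heκ'
        calc (n : ℝ) ^ e * R (n - 1) ≤ (n : ℝ) ^ e * (max 1 (((n - 1 : ℕ) : ℝ) ^ e) * Q (n - 2)) :=
              mul_le_mul_of_nonneg_left hB hne
          _ = (n : ℝ) ^ e * max 1 (((n - 1 : ℕ) : ℝ) ^ e) * Q (n - 2) := (mul_assoc _ _ _).symm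
          _ ≤ (n : ℝ) ^ e * (n : ℝ) ^ e * Q (n - 2) :=
              mul_le_mul_of_nonneg_right (mul_le_mul_of_nonneg_left hmax hne) hQ2
          _ ≤ (n : ℝ) ^ κ' * Q (n - 2) := mul_le_mul_of_nonneg_right hee hQ2
    · -- against `max 1 (n^e) · Q (n-1)`
      calc min (a * (n : ℝ) ^ c) ((n : ℝ) ^ e * R (n - 1)) ≤ (n : ℝ) ^ e * R (n - 1) := min_le_right _ _
        _ ≤ (n : ℝ) ^ e * Q (n - 1) := hA
        _ ≤ max 1 ((n : ℝ) ^ e) * Q (n - 1) := mul_le_mul_of_nonneg_right (le_max_right _ _) hQ1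
  -- conclude by the one-step lemma for `R`, then `R ≤ Q`
  obtain ⟨n₀, hn₀⟩ := eventually_le_of_min_le R a c e ha he0 (max n₁ 1) hR1 hstepR
  exact ⟨n₀, fun n hn => (hn₀ n hn).trans (hRQ n)⟩

end Summit.MatrixMultiplication.MatrixMultiplication.Theorems.PolynomialSlack
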